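import Summits.Ventures.PercRepro.Night2LocalInjection

/-!
# PercRepro — INJ-d1: the open statement of the regime `|E ∖ G| = 1` (night-2, gen 9)

`InjD1` (a conjecture; census in NIGHT-2-local.md §18(d): every loopless matroid on ≤ 8 elements, every
diagonal, every rank-`(q+1)` flat with `|E ∖ G| = 1` — 251 flats — and 427 random / structured matroids on
≤ 13 elements, 0 failures): at a rank-`(q+1)` flat `G` with `|E ∖ G| = 1` the members below `G` inject into
the shadow sets with closure `G` by containment.  By `localShadowHall_of_injection` it gives the local form
(LI_G) at every such flat (`localShadowHall_of_card_compl_one_of_injD1`).  With a coloop of `M|G` the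
injection is trivial (`localShadowHall_of_card_compl_one_of_coloop`); the content of `InjD1` is the
coloop-free case.
-/

namespace PercRepro.Shadow

open Finset PerFlat ThmH

/-- **INJ-d1** (conjecture): at every rank-`(q+1)` flat `G` of every finite matroid with `|E ∖ G| = 1`, the
members below `G` (bottom sets with closure inside `G`) inject into the shadow sets with closure `G` by
containment. -/
def InjD1 : Prop :=
  ∀ {α : Type} [DecidableEq α] (M : Matroid α) [M.Finite] (q : ℕ) (G : Finset α),
    G ∈ flatsQ M (q + 1) → (gr M \ G).card = 1 →
      ∃ ι : Finset α → Finset α,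
        (∀ B ∈ membersIn M (Uq M (q + 2) q) G, ι B ∈ shadowAt M (q + 2) q (Uq M (q + 2) q) G ∧ B ⊆ ι B) ∧
        Set.InjOn ι (membersIn M (Uq M (q + 2) q) G : Set (Finset α))

variable {α : Type} [DecidableEq α] {M : Matroid α} [M.Finite]

open scoped Classical in
/-- **The regime `|E ∖ G| = 1` of the local form modulo INJ-d1.** -/
theorem localShadowHall_of_card_compl_one_of_injD1 (h : InjD1) {q : ℕ} {G : Finset α}
    (hG : G ∈ flatsQ M (q + 1)) (hd : (gr M \ G).card = 1) : LocalShadowHall M q G := by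
  obtain ⟨ι, hι, hinj⟩ := h M q G hG hd
  exact localShadowHall_of_injection hG ι (fun B hB => (hι B hB).1) (fun B hB => (hι B hB).2) hinj

end PercRepro.Shadow
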